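import Mathlib
import Summits.CriticalPhenomena.Ising3DConformalLimit.Theses.GaussianScaleMixture
import Summits.CriticalPhenomena.Ising3DConformalLimit.Theorems.GaussianScaleMixtureCriticalTwoPointGSMGsmClosureOfTight
import Summits.CriticalPhenomena.Ising3DConformalLimit.Theorems.GaussianScaleMixtureCriticalTwoPointGSMExistsExchangeableRepOfRep
import Literature.Probability.LatticeModels.CriticalTwoPointBounds
import Literature.Probability.LatticeModels.CriticalTwoPointLawDimension
import Literature.Probability.LatticeModels.CriticalTwoPointLower
import Literature.Probability.LatticeModels.HighDimPointwiseTriviality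

/-!
# `CriticalTwoPointGSM` (stmt-CriticalPhenomena-8365): constraints on any mixing measure, and two
refuted strengthenings

Standing crux disprover (refuter-cdisprove-stmt-CriticalPhenomena-8365-0), cycle 1 — NEGATIVE lemmas
(no Theses decl is concluded). Write `G = criticalTwoPoint 3` and call a finite measure `ν` on
`ℝ³` carried by the closed octant a *representing measure* if `G(x) = ∫ exp(-∑ sᵢxᵢ²) dν(s)` for all
`x ∈ ℤ³` (the crux asks for an exchangeable probability one). From the tree's rigorous facts
`criticalTwoPoint_tendsto_zero_cofinite` (`G → 0`) and `criticalTwoPoint_bounds_holds`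
(`c‖x‖∞⁻² ≤ G(x) ≤ C‖x‖∞⁻¹`, Simon–Lieb / infrared bound) we prove:

* `measure_plane_eq_zero` — a representing measure gives NO mass to the coordinate planes
  `{sᵢ = 0}` (dominated convergence: `G(n eᵢ) → ν{sᵢ = 0}`);
* `measure_near_plane_ne_zero` — but charges every slab `{sᵢ < ε}`, `ε > 0` (else
  `G(n eᵢ) ≤ ν(ℝ³) e^{-ε n²}`, against `c n⁻²`): the clocks accumulate at every plane;
* `not_finiteGSM` — hence NO FINITE mixture of axis-aligned Gaussians represents `G`
  (strengthening S1 of the crux is false);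
* `not_productForm` — and `G` is NOT multiplicatively separable, i.e. no PRODUCT mixing measure
  (independent clocks) represents it: `G(n,n,n) = G(n,0,0)³ ≤ C³n⁻³` contradicts `c n⁻²`
  (strengthening S2 is false).

Source: the disprover's work file `Cruxes/CriticalTwoPointGSM/Disproof.lean` (same proofs); the
a.e.-octant / continuity / integrability lemmas are REUSED from the provers' files
(`CriticalTwoPointGSMClosure.ae_nonneg_of_octant`, `CriticalTwoPointGSMSymm.continuous_kernel`,
`CriticalTwoPointGSMSymm.integrable_kernel`).
-/

namespace Summit.CriticalPhenomena.Ising3DConformalLimit.CriticalTwoPointGSMNegative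

open MeasureTheory Filter Topology
open Literature.Probability.LatticeModels
open Summit.CriticalPhenomena.Ising3DConformalLimit.Theorems.CriticalTwoPointGSMClosure
  (ae_nonneg_of_octant)
open Summit.CriticalPhenomena.Ising3DConformalLimit.Theorems.CriticalTwoPointGSMSymm
  (continuous_kernel integrable_kernel)
open scoped BigOperators

noncomputable section

/-! ## The Gaussian kernel `s ↦ exp(-∑ᵢ sᵢ xᵢ²)` is bounded by one on the octant -/

/-- On the closed octant the Gaussian kernel is at most one. [folklore] -/
theorem kernel_le_one (x : Site 3) {s : Fin 3 → ℝ} (hs : ∀ i, 0 ≤ s i) :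
    Real.exp (-∑ i, s i * ((x i : ℝ)) ^ 2) ≤ 1 := by
  rw [Real.exp_le_one_iff]
  have : 0 ≤ ∑ i, s i * ((x i : ℝ)) ^ 2 :=
    Finset.sum_nonneg fun i _ => mul_nonneg (hs i) (sq_nonneg _)
  linarith

/-! ## Along a coordinate axis -/

/-- `∑ⱼ sⱼ ((n eᵢ)ⱼ)² = sᵢ n²`. [folklore] -/
theorem sum_single_sq (s : Fin 3 → ℝ) (i : Fin 3) (n : ℤ) :
    ∑ j, s j * (((Pi.single i n : Site 3) j : ℝ)) ^ 2 = s i * (n : ℝ) ^ 2 := by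
  rw [Finset.sum_eq_single i]
  · simp
  · intro j _ hj; simp [Pi.single_eq_of_ne hj]
  · intro h; exact absurd (Finset.mem_univ i) h

/-- `n eᵢ ≠ 0` for `n ≥ 1`. [folklore] -/
theorem single_ne_zero (i : Fin 3) {n : ℕ} (hn : 1 ≤ n) : (Pi.single i (n : ℤ) : Site 3) ≠ 0 := by
  intro h
  have := congrFun h i
  simp at this
  omega

/-- `G(n eᵢ) → 0` (from `criticalTwoPoint_tendsto_zero_cofinite`). [folklore] -/
theorem G_axis_tendsto_zero (i : Fin 3) :
    Tendsto (fun n : ℕ => criticalTwoPoint 3 (Pi.single i (n : ℤ))) atTop (𝓝 0) := by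
  refine criticalTwoPoint_tendsto_zero_cofinite.comp ?_
  rw [← Nat.cofinite_eq_atTop]
  refine Function.Injective.tendsto_cofinite fun a b hab => ?_
  have := congrFun hab i
  simpa using this

/-- The tree's lower bound along an axis (`criticalTwoPoint_bounds_holds`, Simon–Lieb):
`c ≤ n² G(n eᵢ)` for `n ≥ 1`. [folklore] -/
theorem axis_lower_bound : ∃ c : ℝ, 0 < c ∧ ∀ (i : Fin 3) (n : ℕ), 1 ≤ n →
    c ≤ (n : ℝ) ^ 2 * criticalTwoPoint 3 (Pi.single i (n : ℤ)) := by
  obtain ⟨c, C, hc, hbd⟩ := criticalTwoPoint_bounds_holds (d := 3) (by norm_num)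
  refine ⟨c, hc, fun i n hn => ?_⟩
  have h := (hbd _ (single_ne_zero i hn)).1
  rw [Pi.norm_single, Int.norm_natCast] at h
  have hnpos : (0 : ℝ) < n := by exact_mod_cast hn
  have e : ((n : ℝ)) ^ (-(((3 : ℕ) : ℝ) - 1)) = ((n : ℝ) ^ 2)⁻¹ := by
    rw [show (-(((3 : ℕ) : ℝ) - 1)) = -(2 : ℝ) by norm_num, Real.rpow_neg hnpos.le, Real.rpow_two]
  rw [e] at h
  have h2 : 0 < (n : ℝ) ^ 2 := by positivity
  calc c = (n : ℝ) ^ 2 * (c * ((n : ℝ) ^ 2)⁻¹) := by field_simp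
    _ ≤ (n : ℝ) ^ 2 * criticalTwoPoint 3 (Pi.single i (n : ℤ)) :=
        mul_le_mul_of_nonneg_left h h2.le

/-- Hence `n² G(n eᵢ) ↛ 0`: a candidate for `G` that is `o(n⁻²)` along an axis is dead. [folklore] -/
theorem false_of_sq_mul_axis_tendsto_zero (i : Fin 3)
    (h : Tendsto (fun n : ℕ => (n : ℝ) ^ 2 * criticalTwoPoint 3 (Pi.single i (n : ℤ))) atTop (𝓝 0)) :
    False := by
  obtain ⟨c, hc, hlb⟩ := axis_lower_bound
  have : c ≤ 0 :=
    ge_of_tendsto h (Filter.eventually_atTop.mpr ⟨1, fun n hn => hlb i n hn⟩)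
  linarith

/-- `n² e^{-ε n²} → 0`. [folklore] -/
theorem tendsto_sq_mul_exp_neg {ε : ℝ} (hε : 0 < ε) :
    Tendsto (fun n : ℕ => (n : ℝ) ^ 2 * Real.exp (-(ε * (n : ℝ) ^ 2))) atTop (𝓝 0) := by
  have h1 : Tendsto (fun n : ℕ => ε * (n : ℝ) ^ 2) atTop atTop :=
    Tendsto.const_mul_atTop hε ((tendsto_pow_atTop two_ne_zero).comp tendsto_natCast_atTop_atTop)
  have h2 := (Real.tendsto_pow_mul_exp_neg_atTop_nhds_zero 1).comp h1
  have h3 := h2.const_mul ε⁻¹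
  rw [mul_zero] at h3
  refine h3.congr fun n => ?_
  simp only [Function.comp_apply, pow_one]
  field_simp

/-! ## (B1)–(B2): where a representing measure can and must put its mass -/

/-- **No mass on the coordinate planes.** If a finite measure `ν` carried by the closed octant
represents the critical two-point function, then `ν{sᵢ = 0} = 0` for each `i`: indeed
`G(n eᵢ) = ∫ e^{-sᵢn²}dν → ν{sᵢ = 0}` by dominated convergence while `G(n eᵢ) → 0`. So the constant
kernel (and every kernel frozen in one direction) carries no weight. [folklore] -/
theorem measure_plane_eq_zero {ν : Measure (Fin 3 → ℝ)} [IsFiniteMeasure ν]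
    (hoct : ν {s | ∃ i, s i < 0} = 0)
    (hrep : ∀ x : Site 3, criticalTwoPoint 3 x = ∫ s, Real.exp (-∑ i, s i * ((x i : ℝ)) ^ 2) ∂ν)
    (i : Fin 3) : ν {s | s i = 0} = 0 := by
  have hmeas : MeasurableSet {s : Fin 3 → ℝ | s i = 0} :=
    measurableSet_eq_fun (measurable_pi_apply i) measurable_const
  have hlim : Tendsto (fun n : ℕ => ∫ s, Real.exp (-∑ j, s j *
      (((Pi.single i (n : ℤ) : Site 3) j : ℝ)) ^ 2) ∂ν) atTop
      (𝓝 (∫ s, Set.indicator {s : Fin 3 → ℝ | s i = 0} (1 : (Fin 3 → ℝ) → ℝ) s ∂ν)) := by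
    refine tendsto_integral_of_dominated_convergence (fun _ => (1 : ℝ))
      (fun n => (continuous_kernel _).aestronglyMeasurable) (integrable_const 1) ?_ ?_
    · intro n
      filter_upwards [ae_nonneg_of_octant hoct] with s hs
      rw [Real.norm_eq_abs, abs_of_pos (Real.exp_pos _)]
      exact kernel_le_one _ hs
    · filter_upwards [ae_nonneg_of_octant hoct] with s hs
      simp_rw [sum_single_sq]
      by_cases h0 : s i = 0
      · simp only [h0, zero_mul, neg_zero, Real.exp_zero,
          Set.indicator_of_mem (show s ∈ {s : Fin 3 → ℝ | s i = 0} from h0), Pi.one_apply]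
        exact tendsto_const_nhds
      · have hpos : 0 < s i := lt_of_le_of_ne (hs i) (Ne.symm h0)
        rw [Set.indicator_of_notMem (show s ∉ {s : Fin 3 → ℝ | s i = 0} from h0)]
        have e : (fun n : ℕ => Real.exp (-(s i * (((n : ℤ) : ℝ)) ^ 2))) =
            fun n : ℕ => Real.exp (-(s i * (n : ℝ) ^ 2)) := by
          funext n; push_cast; ring_nf
        rw [e]
        refine Real.tendsto_exp_atBot.comp ?_
        rw [tendsto_neg_atBot_iff]
        exact Tendsto.const_mul_atTop hpos
          ((tendsto_pow_atTop two_ne_zero).comp tendsto_natCast_atTop_atTop)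
  rw [integral_indicator_one hmeas] at hlim
  have hlim' : Tendsto (fun n : ℕ => criticalTwoPoint 3 (Pi.single i (n : ℤ))) atTop
      (𝓝 ((ν {s | s i = 0}).toReal)) :=
    hlim.congr fun n => (hrep _).symm
  have h0 := tendsto_nhds_unique hlim' (G_axis_tendsto_zero i)
  exact ((ENNReal.toReal_eq_zero_iff _).mp h0).resolve_right (measure_ne_top ν _)

/-- **Mass accumulates at every coordinate plane.** A representing measure charges every slab
`{sᵢ < ε}`, `ε > 0` — otherwise `G(n eᵢ) ≤ ν(ℝ³) e^{-ε n²}`, against Simon's lower bound `c n⁻²`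
(`criticalTwoPoint_bounds_holds`). With `measure_plane_eq_zero`: every marginal of `ν` accumulates
at `0` without charging it — infinitely many arbitrarily slow clocks. [folklore] -/
theorem measure_near_plane_ne_zero {ν : Measure (Fin 3 → ℝ)} [IsFiniteMeasure ν]
    (hoct : ν {s | ∃ i, s i < 0} = 0)
    (hrep : ∀ x : Site 3, criticalTwoPoint 3 x = ∫ s, Real.exp (-∑ i, s i * ((x i : ℝ)) ^ 2) ∂ν)
    (i : Fin 3) {ε : ℝ} (hε : 0 < ε) : ν {s | s i < ε} ≠ 0 := by
  intro h0
  have hae : ∀ᵐ s ∂ν, ε ≤ s i := by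
    rw [ae_iff]; simpa [not_le] using h0
  set M := (ν Set.univ).toReal with hM
  have hub : ∀ n : ℕ, criticalTwoPoint 3 (Pi.single i (n : ℤ)) ≤
      M * Real.exp (-(ε * (n : ℝ) ^ 2)) := by
    intro n
    have h1 : ∫ s, Real.exp (-∑ j, s j * (((Pi.single i (n : ℤ) : Site 3) j : ℝ)) ^ 2) ∂ν ≤
        ∫ _s, Real.exp (-(ε * (n : ℝ) ^ 2)) ∂ν := by
      refine integral_mono_ae (integrable_kernel hoct _) (integrable_const _) ?_
      filter_upwards [hae] with s hs
      rw [sum_single_sq]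
      push_cast
      apply Real.exp_le_exp.mpr
      nlinarith [sq_nonneg (n : ℝ)]
    rw [integral_const, smul_eq_mul] at h1
    rw [hrep]
    calc _ ≤ _ := h1
      _ = M * Real.exp (-(ε * (n : ℝ) ^ 2)) := by rw [hM]; rfl
  have hlim : Tendsto (fun n : ℕ => M * ((n : ℝ) ^ 2 * Real.exp (-(ε * (n : ℝ) ^ 2)))) atTop
      (𝓝 0) := by
    simpa using (tendsto_sq_mul_exp_neg hε).const_mul M
  refine false_of_sq_mul_axis_tendsto_zero i ?_
  refine squeeze_zero (fun n => mul_nonneg (sq_nonneg _) (criticalTwoPoint_nonneg' _))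
    (fun n => ?_) hlim
  calc _ ≤ (n : ℝ) ^ 2 * (M * Real.exp (-(ε * (n : ℝ) ^ 2))) :=
        mul_le_mul_of_nonneg_left (hub n) (sq_nonneg _)
    _ = _ := by ring

/-! ## Two refuted strengthenings of the crux -/

/-- **Strengthening S1 (finite Gaussian mixture) is false.** No finite nonnegative combination of
axis-aligned Gaussian kernels `exp(-∑ aₖᵢ xᵢ²)`, `aₖᵢ ≥ 0`, equals the critical two-point function
on `ℤ³`: an atom frozen along `e₀` (`aₖ₀ = 0`) must have weight `0` because `G(n e₀) → 0`, and then
`n² G(n e₀) → 0`, against `c n⁻²`. [folklore] -/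
theorem not_finiteGSM :
    ¬ ∃ (m : ℕ) (w : Fin m → ℝ) (a : Fin m → (Fin 3 → ℝ)), (∀ k, 0 ≤ w k) ∧ (∀ k i, 0 ≤ a k i) ∧
      ∀ x : Site 3, criticalTwoPoint 3 x =
        ∑ k, w k * Real.exp (-∑ i, a k i * ((x i : ℝ)) ^ 2) := by
  rintro ⟨m, w, a, hw, ha, hrep⟩
  have hrep0 : ∀ n : ℕ, criticalTwoPoint 3 (Pi.single 0 (n : ℤ)) =
      ∑ k, w k * Real.exp (-(a k 0 * (n : ℝ) ^ 2)) := by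
    intro n; rw [hrep]
    refine Finset.sum_congr rfl fun k _ => ?_
    rw [sum_single_sq, Int.cast_natCast]
  have hzero : ∀ k, a k 0 = 0 → w k = 0 := by
    intro k hk
    have hle : ∀ n : ℕ, w k ≤ criticalTwoPoint 3 (Pi.single 0 (n : ℤ)) := by
      intro n
      rw [hrep0]
      calc w k = w k * Real.exp (-(a k 0 * (n : ℝ) ^ 2)) := by rw [hk]; simp
        _ ≤ ∑ j, w j * Real.exp (-(a j 0 * (n : ℝ) ^ 2)) :=
          Finset.single_le_sum (f := fun j => w j * Real.exp (-(a j 0 * (n : ℝ) ^ 2)))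
            (fun j _ => mul_nonneg (hw j) (Real.exp_pos _).le) (Finset.mem_univ k)
    have : w k ≤ 0 := ge_of_tendsto (G_axis_tendsto_zero 0) (Eventually.of_forall hle)
    exact le_antisymm this (hw k)
  have hterm : ∀ k, Tendsto (fun n : ℕ => w k * ((n : ℝ) ^ 2 * Real.exp (-(a k 0 * (n : ℝ) ^ 2))))
      atTop (𝓝 0) := by
    intro k
    rcases (ha k 0).eq_or_lt with h0 | hpos
    · have hw0 : w k = 0 := hzero k h0.symm
      simp only [hw0, zero_mul]
      exact tendsto_const_nhds
    · simpa using (tendsto_sq_mul_exp_neg hpos).const_mul (w k)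
  refine false_of_sq_mul_axis_tendsto_zero 0 ?_
  have e : (fun n : ℕ => (n : ℝ) ^ 2 * criticalTwoPoint 3 (Pi.single 0 (n : ℤ))) =
      fun n : ℕ => ∑ k, w k * ((n : ℝ) ^ 2 * Real.exp (-(a k 0 * (n : ℝ) ^ 2))) := by
    funext n; rw [hrep0, Finset.mul_sum]; refine Finset.sum_congr rfl fun k _ => ?_; ring
  rw [e, show (0 : ℝ) = ∑ _k : Fin m, (0 : ℝ) by simp]
  exact tendsto_finsetSum _ fun k _ => hterm k

/-- **Strengthening S2 (product mixing measure / separable `G`) is false.** The critical two-point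
function is not of the form `g(x₀) g(x₁) g(x₂)`: separability gives `G(n,n,n) = G(n,0,0)³ ≤ C³ n⁻³`
(infrared upper bound) against Simon's `c‖(n,n,n)‖∞⁻² = c n⁻²`. So the three clocks of any
Gaussian-scale-mixture representation are dependent. [folklore] -/
theorem not_productForm :
    ¬ ∃ g : ℤ → ℝ, ∀ x : Site 3, criticalTwoPoint 3 x = g (x 0) * g (x 1) * g (x 2) := by
  rintro ⟨g, hg⟩
  obtain ⟨c, C, hc, hbd⟩ := criticalTwoPoint_bounds_holds (d := 3) (by norm_num)
  have hg0 : g 0 ^ 6 = 1 := by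
    have h := hg 0
    rw [criticalTwoPoint_zero'] at h
    simp only [Pi.zero_apply] at h
    nlinarith [h]
  have hcube : ∀ n : ℤ, criticalTwoPoint 3 (fun _ => n) = criticalTwoPoint 3 (Pi.single 0 n) ^ 3 := by
    intro n
    rw [hg (fun _ => n), hg (Pi.single 0 n)]
    simp only [Pi.single_eq_same, Pi.single_eq_of_ne (show (1 : Fin 3) ≠ 0 by decide),
      Pi.single_eq_of_ne (show (2 : Fin 3) ≠ 0 by decide)]
    calc g n * g n * g n = g n ^ 3 * 1 := by ring
      _ = g n ^ 3 * g 0 ^ 6 := by rw [hg0]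
      _ = (g n * g 0 * g 0) ^ 3 := by ring
  have key : ∀ n : ℕ, 1 ≤ n → c * (n : ℝ) ≤ C ^ 3 := by
    intro n hn
    have hnpos : (0 : ℝ) < n := by exact_mod_cast hn
    have hdiag_ne : (fun _ => (n : ℤ) : Site 3) ≠ 0 := by
      intro h; have := congrFun h 0; simp at this; omega
    have hl := (hbd _ hdiag_ne).1
    have hu := (hbd _ (single_ne_zero 0 hn)).2
    rw [pi_norm_const, Int.norm_natCast] at hl
    rw [Pi.norm_single, Int.norm_natCast] at hu
    rw [show (-(((3 : ℕ) : ℝ) - 1)) = -(2 : ℝ) by norm_num, Real.rpow_neg hnpos.le,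
      Real.rpow_two] at hl
    rw [show (-(((3 : ℕ) : ℝ) - 2)) = -(1 : ℝ) by norm_num, Real.rpow_neg hnpos.le,
      Real.rpow_one] at hu
    have hG0 : 0 ≤ criticalTwoPoint 3 (Pi.single 0 (n : ℤ)) := criticalTwoPoint_nonneg' _
    have hu3 : criticalTwoPoint 3 (Pi.single 0 (n : ℤ)) ^ 3 ≤ (C * ((n : ℝ))⁻¹) ^ 3 :=
      pow_le_pow_left₀ hG0 hu 3
    rw [← hcube] at hu3
    have h1 : c * ((n : ℝ) ^ 2)⁻¹ ≤ C ^ 3 * ((n : ℝ) ^ 3)⁻¹ := by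
      calc _ ≤ _ := hl
        _ ≤ _ := hu3
        _ = _ := by ring
    have h3 : (0 : ℝ) < (n : ℝ) ^ 3 := by positivity
    have := mul_le_mul_of_nonneg_right h1 h3.le
    calc c * (n : ℝ) = c * ((n : ℝ) ^ 2)⁻¹ * (n : ℝ) ^ 3 := by field_simp
      _ ≤ C ^ 3 * ((n : ℝ) ^ 3)⁻¹ * (n : ℝ) ^ 3 := this
      _ = C ^ 3 := by field_simp
  obtain ⟨N, hN⟩ := exists_nat_gt (C ^ 3 / c)
  have h1 := key (max N 1) (le_max_right _ _)
  have h2 : C ^ 3 / c < (max N 1 : ℕ) := hN.trans_le (by exact_mod_cast le_max_left N 1)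
  rw [div_lt_iff₀ hc] at h2
  linarith

end

end Summit.CriticalPhenomena.Ising3DConformalLimit.CriticalTwoPointGSMNegative
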